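import Literature.Probability.Moments.HerbstArgument
import HarnessLib

/-!
# Herbst's argument with a RESTRICTED range of tilts: moderate deviations

Pure measure-theoretic probability; everything in this file is proved (no definitions, no
named facts).  Companion of `Literature.Probability.Moments.HerbstArgument`, which assumes the
entropy inequality `Ent_ν(e^{lψ}) ≤ c l² ∫ e^{lψ} dν` for EVERY real `l` and returns Gaussian
concentration at every level `r ≥ 0`.

Here the entropy inequality is assumed only for tilts in a bounded window `0 < l ≤ l₀`
(Bakry–Gentil–Ledoux 2014, Prop. 5.4.1: the proof integrates `(Λ(l)/l)' ≤ c` from `0` to `l`, so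
it only ever uses the inequality on `(0, l]`).  The conclusions are correspondingly windowed:

* `cgf_le_of_entropy_le_on_Ioc` — `log ∫ e^{lψ} dν ≤ l ∫ψ dν + c l²` for `0 < l ≤ l₀`;
* `measureReal_ge_le_exp_of_entropy_le_on_Ioc` — the Chernoff bound
  `ν{ψ − ∫ψ ≥ r} ≤ exp(−l r + c l²)` for every tilt `0 < l ≤ l₀` of the window;
* `herbst_tail_le_of_entropy_le_on_Ioc` — GAUSSIAN concentration `ν{ψ − ∫ψ ≥ r} ≤ e^{−r²/(4c)}`
  in the MODERATE-DEVIATION window `0 ≤ r ≤ 2 c l₀` (the optimal tilt `l = r/(2c)` lies in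
  `(0, l₀]`);
* `herbst_exp_tail_le_of_entropy_le_on_Ioc` — EXPONENTIAL concentration
  `ν{ψ − ∫ψ ≥ r} ≤ e^{−l₀ r/2}` beyond it, `2 c l₀ ≤ r` (tilt `l = l₀`).

This is the form in which a logarithmic Sobolev / entropy inequality that is only available for
SMALL tilts of a Gibbs measure (tilted measures `e^{lψ}ν/Z` that stay in a perturbative regime)
still yields Gaussian concentration up to a moderate-deviation threshold.

## References

* D. Bakry, I. Gentil, M. Ledoux, *Analysis and Geometry of Markov Diffusion Operators*,
  Grundlehren 348, Springer (2014), Prop. 5.4.1, (5.4.1)–(5.4.2). [BakryGentilLedoux2014]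
* M. Ledoux, *The Concentration of Measure Phenomenon*, AMS (2001), §5.1 (Herbst's argument).
-/

namespace Literature.Probability.Moments

open _root_.MeasureTheory _root_.ProbabilityTheory _root_.Real _root_.Filter _root_.Set
open scoped _root_.Topology

variable {α : Type*} [MeasurableSpace α]

section HerbstRestricted

variable (ν : Measure α) [IsProbabilityMeasure ν] {ψ : α → ℝ} {C c l₀ : ℝ}

/-- **Herbst's argument on a window of tilts.** If `ψ` is bounded and measurable, `c > 0`, and
`Ent_ν(e^{lψ}) ≤ c l² ∫ e^{lψ} dν` for every `0 < l ≤ l₀`, then for every `0 < l ≤ l₀` the cumulant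
generating function satisfies `log ∫ e^{lψ} dν ≤ l ∫ ψ dν + c l²`
(Bakry–Gentil–Ledoux: `(Λ(l)/l − c l)' ≤ 0` on `(0, l₀]` and `Λ(l)/l → ∫ψ` as `l → 0⁺`).
[cite: BakryGentilLedoux2014, Prop. 5.4.1] -/
theorem cgf_le_of_entropy_le_on_Ioc (hψ : Measurable ψ) (hC : ∀ y, |ψ y| ≤ C) (hc : 0 < c)
    (hEnt : ∀ l : ℝ, 0 < l → l ≤ l₀ → ∫ y, exp (l * ψ y) * (l * ψ y) ∂ν -
      (∫ y, exp (l * ψ y) ∂ν) * log (∫ y, exp (l * ψ y) ∂ν) ≤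
        c * l ^ 2 * ∫ y, exp (l * ψ y) ∂ν)
    {l : ℝ} (hl : 0 < l) (hl₀ : l ≤ l₀) :
    cgf ψ ν l ≤ l * ∫ z, ψ z ∂ν + c * l ^ 2 := by
  have hint : ∀ t : ℝ, Integrable (fun y => exp (t * ψ y)) ν :=
    integrable_exp_mul_of_abs_le_const ν hψ hC
  have hmem : ∀ t : ℝ, t ∈ interior (integrableExpSet ψ ν) := fun t => by
    rw [(eq_univ_of_forall hint : integrableExpSet ψ ν = univ), interior_univ]
    exact mem_univ t
  have hZ : ∀ t, 0 < mgf ψ ν t := fun t => mgf_pos (hint t)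
  -- `Λ = cgf ψ ν` is differentiable with derivative `Λ' = Z' / Z`
  set Λ' : ℝ → ℝ := fun t => (∫ y, ψ y * exp (t * ψ y) ∂ν) / mgf ψ ν t with hΛ'
  have hΛd : ∀ t, HasDerivAt (cgf ψ ν) (Λ' t) t := fun t =>
    (hasDerivAt_mgf (hmem t)).log (hZ t).ne'
  -- on the window the hypothesis reads `t Λ' t - Λ t ≤ c t²`
  have hkey : ∀ t, 0 < t → t ≤ l₀ → t * Λ' t - cgf ψ ν t ≤ c * t ^ 2 := fun t ht htl => by
    have h := hEnt t ht htl
    have h2 : ∫ y, exp (t * ψ y) * (t * ψ y) ∂ν = t * ∫ y, ψ y * exp (t * ψ y) ∂ν := by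
      rw [← integral_const_mul]
      exact integral_congr_ae (ae_of_all _ fun y => by ring)
    rw [h2] at h
    change t * (∫ y, ψ y * exp (t * ψ y) ∂ν) - mgf ψ ν t * log (mgf ψ ν t) ≤
      c * t ^ 2 * mgf ψ ν t at h
    have hZt := hZ t
    have hI : ∫ y, ψ y * exp (t * ψ y) ∂ν = Λ' t * mgf ψ ν t := by
      rw [hΛ', div_mul_cancel₀ _ hZt.ne']
    rw [hI] at h
    have h' : mgf ψ ν t * (t * Λ' t - log (mgf ψ ν t) - c * t ^ 2) ≤ 0 := by nlinarith [h]
    exact sub_nonpos.1 (nonpos_of_mul_nonpos_right h' hZt)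
  -- `K t = Λ t / t - c t` is non-increasing on the window `(0, l₀]`
  set K : ℝ → ℝ := fun t => cgf ψ ν t / t - c * t with hK
  have hKd : ∀ t, t ≠ 0 →
      HasDerivAt K ((Λ' t * t - cgf ψ ν t * 1) / t ^ 2 - c * 1) t := fun t ht =>
    ((hΛd t).div (hasDerivAt_id' t) ht).sub ((hasDerivAt_id' t).const_mul c)
  have hanti : AntitoneOn K (Ioc 0 l₀) := by
    refine antitoneOn_of_deriv_nonpos (convex_Ioc 0 l₀)
      (fun t ht => (hKd t (ne_of_gt ht.1)).continuousAt.continuousWithinAt)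
      (fun t ht => (hKd t (ne_of_gt (interior_subset ht).1)).differentiableAt.differentiableWithinAt)
      fun t ht => ?_
    rw [interior_Ioc] at ht
    have ht' : (0 : ℝ) < t := ht.1
    rw [(hKd t ht'.ne').deriv, mul_one, mul_one, sub_nonpos, div_le_iff₀ (pow_pos ht' 2)]
    have := hkey t ht' ht.2.le
    linarith
  -- `K t → Λ' 0 = ∫ψ` as `t → 0⁺`
  have h0 : cgf ψ ν 0 = 0 := cgf_zero
  have hΛ'0 : Λ' 0 = ∫ z, ψ z ∂ν := by simp [hΛ']
  have htend : Tendsto (fun s => cgf ψ ν s / s) (𝓝[>] 0) (𝓝 (∫ z, ψ z ∂ν)) := by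
    have h := hΛd 0
    rw [hasDerivAt_iff_tendsto_slope_zero, hΛ'0] at h
    simp only [zero_add, h0, sub_zero, smul_eq_mul] at h
    refine (h.mono_left (nhdsGT_le_nhdsNE 0)).congr fun s => ?_
    rw [inv_mul_eq_div]
  have hKl : K l ≤ ∫ z, ψ z ∂ν := by
    refine ge_of_tendsto htend ?_
    filter_upwards [Ioo_mem_nhdsGT hl] with s hs
    have h1 : K l ≤ K s := hanti ⟨hs.1, hs.2.le.trans hl₀⟩ ⟨hl, hl₀⟩ hs.2.le
    have h2 : K s ≤ cgf ψ ν s / s := by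
      have : 0 ≤ c * s := mul_nonneg hc.le hs.1.le
      simp only [hK]
      linarith
    exact h1.trans h2
  have hKl' : cgf ψ ν l / l - c * l ≤ ∫ z, ψ z ∂ν := hKl
  rw [sub_le_iff_le_add, div_le_iff₀ hl] at hKl'
  nlinarith [hKl']

/-- **Chernoff bound at a tilt of the window.** Under the hypotheses of
`cgf_le_of_entropy_le_on_Ioc`, for every tilt `0 < l ≤ l₀` and every real `r`:
`ν {ψ − ∫ψ dν ≥ r} ≤ exp (−l r + c l²)`. [cite: BakryGentilLedoux2014, Prop. 5.4.1] -/
theorem measureReal_ge_le_exp_of_entropy_le_on_Ioc (hψ : Measurable ψ) (hC : ∀ y, |ψ y| ≤ C)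
    (hc : 0 < c)
    (hEnt : ∀ l : ℝ, 0 < l → l ≤ l₀ → ∫ y, exp (l * ψ y) * (l * ψ y) ∂ν -
      (∫ y, exp (l * ψ y) ∂ν) * log (∫ y, exp (l * ψ y) ∂ν) ≤
        c * l ^ 2 * ∫ y, exp (l * ψ y) ∂ν)
    {l : ℝ} (hl : 0 < l) (hl₀ : l ≤ l₀) (r : ℝ) :
    ν.real {y | r ≤ ψ y - ∫ z, ψ z ∂ν} ≤ exp (-(l * r) + c * l ^ 2) := by
  have hint := integrable_exp_mul_of_abs_le_const ν hψ hC l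
  have hcgf := cgf_le_of_entropy_le_on_Ioc ν hψ hC hc hEnt hl hl₀
  have hset : {y | r ≤ ψ y - ∫ z, ψ z ∂ν} = {y | r + ∫ z, ψ z ∂ν ≤ ψ y} := by
    ext y
    simp only [mem_setOf_eq, le_sub_iff_add_le]
  rw [hset]
  refine (measure_ge_le_exp_cgf (r + ∫ z, ψ z ∂ν) hl.le hint).trans ?_
  rw [exp_le_exp]
  nlinarith [hcgf]

/-- **Gaussian concentration in the moderate-deviation window.** If `ψ` is bounded and
measurable, `c > 0`, `0 < l₀`, and `Ent_ν(e^{lψ}) ≤ c l² ∫ e^{lψ} dν` for every `0 < l ≤ l₀`, then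
`ν {ψ − ∫ψ dν ≥ r} ≤ exp (−r²/(4c))` for every `0 ≤ r ≤ 2 c l₀` (Chernoff at the optimal tilt
`l = r/(2c) ∈ (0, l₀]`). [cite: BakryGentilLedoux2014, Prop. 5.4.1] -/
theorem herbst_tail_le_of_entropy_le_on_Ioc (hψ : Measurable ψ) (hC : ∀ y, |ψ y| ≤ C)
    (hc : 0 < c)
    (hEnt : ∀ l : ℝ, 0 < l → l ≤ l₀ → ∫ y, exp (l * ψ y) * (l * ψ y) ∂ν -
      (∫ y, exp (l * ψ y) ∂ν) * log (∫ y, exp (l * ψ y) ∂ν) ≤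
        c * l ^ 2 * ∫ y, exp (l * ψ y) ∂ν)
    {r : ℝ} (hr : 0 ≤ r) (hrw : r ≤ 2 * c * l₀) :
    ν.real {y | r ≤ ψ y - ∫ z, ψ z ∂ν} ≤ exp (-r ^ 2 / (4 * c)) := by
  rcases hr.eq_or_lt with h0 | hr0
  · -- `r = 0`: the bound is `1`
    rw [← h0]
    have h1 : ν.real {y | (0 : ℝ) ≤ ψ y - ∫ z, ψ z ∂ν} ≤ 1 := measureReal_le_one
    have h2 : exp (-(0 : ℝ) ^ 2 / (4 * c)) = 1 := by simp
    rw [h2]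
    exact h1
  · have hl : 0 < r / (2 * c) := by positivity
    have hl₀ : r / (2 * c) ≤ l₀ := by
      rw [div_le_iff₀ (by positivity)]
      linarith
    refine (measureReal_ge_le_exp_of_entropy_le_on_Ioc ν hψ hC hc hEnt hl hl₀ r).trans_eq ?_
    congr 1
    field_simp
    ring

/-- **Exponential concentration beyond the window.** Under the same hypotheses, for
`2 c l₀ ≤ r`: `ν {ψ − ∫ψ dν ≥ r} ≤ exp (−l₀ r/2)` (Chernoff at the maximal tilt `l = l₀`, using
`c l₀² ≤ l₀ r/2`). [cite: BakryGentilLedoux2014, Prop. 5.4.1] -/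
theorem herbst_exp_tail_le_of_entropy_le_on_Ioc (hψ : Measurable ψ) (hC : ∀ y, |ψ y| ≤ C)
    (hc : 0 < c) (hl₀ : 0 < l₀)
    (hEnt : ∀ l : ℝ, 0 < l → l ≤ l₀ → ∫ y, exp (l * ψ y) * (l * ψ y) ∂ν -
      (∫ y, exp (l * ψ y) ∂ν) * log (∫ y, exp (l * ψ y) ∂ν) ≤
        c * l ^ 2 * ∫ y, exp (l * ψ y) ∂ν)
    {r : ℝ} (hrw : 2 * c * l₀ ≤ r) :
    ν.real {y | r ≤ ψ y - ∫ z, ψ z ∂ν} ≤ exp (-(l₀ * r / 2)) := by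
  refine (measureReal_ge_le_exp_of_entropy_le_on_Ioc ν hψ hC hc hEnt hl₀ le_rfl r).trans ?_
  rw [exp_le_exp]
  nlinarith [mul_le_mul_of_nonneg_left hrw hl₀.le]

/-- **Herbst's argument on a window of tilts, packaged.** Let `ν` be a probability measure, `ψ`
bounded measurable with mean `m = ∫ ψ dν`, `c > 0`, `l₀ > 0`, and suppose the entropy
inequality `Ent_ν(e^{lψ}) ≤ c l² ∫ e^{lψ} dν` for every tilt `0 < l ≤ l₀`.  Then
(i) `ν {ψ − m ≥ r} ≤ e^{−r²/(4c)}` for `0 ≤ r ≤ 2 c l₀` (Gaussian, moderate deviations) and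
(ii) `ν {ψ − m ≥ r} ≤ e^{−l₀ r/2}` for `r ≥ 2 c l₀` (exponential, large deviations).
[cite: BakryGentilLedoux2014, Prop. 5.4.1] -/
theorem herbst_windowed_tail_bound (ν : Measure α) [IsProbabilityMeasure ν] {ψ : α → ℝ}
    (hψ : Measurable ψ) (hbdd : ∃ C : ℝ, ∀ y, |ψ y| ≤ C) {c l₀ : ℝ} (hc : 0 < c) (hl₀ : 0 < l₀)
    (hEnt : ∀ l : ℝ, 0 < l → l ≤ l₀ → ∫ y, Real.exp (l * ψ y) * (l * ψ y) ∂ν -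
      (∫ y, Real.exp (l * ψ y) ∂ν) * Real.log (∫ y, Real.exp (l * ψ y) ∂ν) ≤
        c * l ^ 2 * ∫ y, Real.exp (l * ψ y) ∂ν) :
    (∀ r : ℝ, 0 ≤ r → r ≤ 2 * c * l₀ →
      ν.real {y | r ≤ ψ y - ∫ z, ψ z ∂ν} ≤ Real.exp (-r ^ 2 / (4 * c))) ∧
    (∀ r : ℝ, 2 * c * l₀ ≤ r →
      ν.real {y | r ≤ ψ y - ∫ z, ψ z ∂ν} ≤ Real.exp (-(l₀ * r / 2))) := by
  obtain ⟨C, hC⟩ := hbdd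
  exact ⟨fun r hr hrw => herbst_tail_le_of_entropy_le_on_Ioc ν hψ hC hc hEnt hr hrw,
    fun r hrw => herbst_exp_tail_le_of_entropy_le_on_Ioc ν hψ hC hc hl₀ hEnt hrw⟩

end HerbstRestricted

end Literature.Probability.Moments
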